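import Mathlib
import HarnessLib

/-!
# The power-counting inequalities of the sup-norm route to stub B1b″
(crux `EmbeddedDrudeMourre.DrudeDissolution`, item stmt-AtomisticToContinuum-12593; `--supports` file for the
registered sub-goal `supAlgebra_powerCounting` of stub B1b″ `stub_excursionSecondDifference` of line
`kinetic-polymer-gas-on-the-time-axis`; closes nothing; lead c13 (process B), 2026-08-17)

WHAT. Elementary real inequalities. At a point of the period cell write `x = |S₁|`, `y = |S₂|`
(the two exchange-plane coordinates `Sᵢ = sin(sᵢ/2)`) and `z = |A|` (the smooth cofactor of the
factorisation `Ω = A·S₁·S₂` of the pair resonance); the floor of the gradient is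
`μ = z²x² + z²y² + x²y²` (`|∇Ω|² ≳ μ`), the weight is `W ≲ x²y²`, `|∇W| ≲ xy(x+y)`, `|∇²W| ≲ x²+y²`, the
second derivatives of `Ω` are `≲ n = x+y+z`, and on the support of the cut-off amplitude (cutoffs of width
`η` around the three curves `{x=y=0}`, `{x=z=0}`, `{y=z=0}`) one has the three SUPPORT CONDITIONS
`η² ≤ x²+y²`, `η² ≤ x²+z²`, `η² ≤ y²+z²`. Then (`supAlgebra_*`):
* `η⁴/4 ≤ μ` (at most one of `x, y, z` is below `η/√2`);
* `x²+y²+z² ≤ 3μ/η²` and `(x+y+z)² ≤ 9μ/η²` (the largest of the three carries the other two);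
* `x·y ≤ √μ`;
and consequently the four terms of the pointwise flux bound are each `O(η⁻²)`:
`(x²+y²)/μ ≤ 3/η²`, `xy(x+y)/(ημ) ≤ 3/η²`, `x²y²/(η²μ) ≤ 1/η²`, `xy(x+y)(x+y+z)/μ^{3/2} ≤ 9/η²`,
`x²y²(x+y+z)/(ημ^{3/2}) ≤ 3/η²`, `x²y²/μ^{3/2} ≤ 2/η²`, `x²y²(x+y+z)²/μ² ≤ 9/η²`
(`supAlgebra_powerCounting`, registered).

WHY (role). With `g₀ ≲ x²y²`, `g₁ ≲ xy(x+y) + x²y²/η`, `g₂ ≲ x²+y² + xy(x+y)/η + x²y²/η²` (weight times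
cutoff) and `m² ≳ μ`, `n ≲ x+y+z`, `t ≲ 1` in `flux_pointwise_bound`, these inequalities give
`sup |L(LG)| ≲ η⁻²`; together with the discarded tube mass `≲ η⁴` and `η = δ^{1/3}`: `δ^{4/3}`.
-/

noncomputable section

namespace Summit.AtomisticToContinuum.FouriersLaw.Theorems.DrudeDissolution.KineticPolymerGasOnTheTimeAxis

/-- **At most one small coordinate.** Under the support conditions, `η⁴/4 ≤ μ`. [folklore] -/
theorem supAlgebra_mu_ge {x y z η : ℝ}
    (hxy : η ^ 2 ≤ x ^ 2 + y ^ 2) (hxz : η ^ 2 ≤ x ^ 2 + z ^ 2) (hyz : η ^ 2 ≤ y ^ 2 + z ^ 2) :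
    η ^ 4 / 4 ≤ z ^ 2 * x ^ 2 + z ^ 2 * y ^ 2 + x ^ 2 * y ^ 2 := by
  -- at most one of x², y², z² is below η²/2
  by_cases h1 : x ^ 2 < η ^ 2 / 2
  · -- then y² ≥ η²/2 and z² ≥ η²/2
    have hy2 : η ^ 2 / 2 ≤ y ^ 2 := by linarith
    have hz2 : η ^ 2 / 2 ≤ z ^ 2 := by linarith
    have : η ^ 2 / 2 * (η ^ 2 / 2) ≤ z ^ 2 * y ^ 2 := mul_le_mul hz2 hy2 (by positivity) (by positivity)
    nlinarith [sq_nonneg x, sq_nonneg y, sq_nonneg z, mul_nonneg (sq_nonneg z) (sq_nonneg x),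
      mul_nonneg (sq_nonneg x) (sq_nonneg y)]
  · push Not at h1
    by_cases h2 : y ^ 2 < η ^ 2 / 2
    · have hz2 : η ^ 2 / 2 ≤ z ^ 2 := by linarith
      have : η ^ 2 / 2 * (η ^ 2 / 2) ≤ z ^ 2 * x ^ 2 := mul_le_mul hz2 h1 (by positivity) (by positivity)
      nlinarith [mul_nonneg (sq_nonneg z) (sq_nonneg y), mul_nonneg (sq_nonneg x) (sq_nonneg y)]
    · push Not at h2
      have : η ^ 2 / 2 * (η ^ 2 / 2) ≤ x ^ 2 * y ^ 2 := mul_le_mul h1 h2 (by positivity) (by positivity)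
      nlinarith [mul_nonneg (sq_nonneg z) (sq_nonneg y), mul_nonneg (sq_nonneg z) (sq_nonneg x)]

/-- **The largest coordinate carries the other two.** `x²+y²+z² ≤ 3μ/η²`, written without division:
`η²(x²+y²+z²) ≤ 3μ`. [folklore] -/
theorem supAlgebra_sumSq_le {x y z η : ℝ}
    (hxy : η ^ 2 ≤ x ^ 2 + y ^ 2) (hxz : η ^ 2 ≤ x ^ 2 + z ^ 2) (hyz : η ^ 2 ≤ y ^ 2 + z ^ 2) :
    η ^ 2 * (x ^ 2 + y ^ 2 + z ^ 2) ≤ 3 * (z ^ 2 * x ^ 2 + z ^ 2 * y ^ 2 + x ^ 2 * y ^ 2) := by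
  -- case on the largest of x², y², z²
  rcases le_total (x ^ 2) (z ^ 2) with hxz' | hzx'
  · rcases le_total (y ^ 2) (z ^ 2) with hyz' | hzy'
    · -- z largest: μ ≥ z²(x²+y²) ≥ z²η², and x²+y²+z² ≤ 3z²
      nlinarith [mul_le_mul_of_nonneg_left hxy (sq_nonneg z), mul_nonneg (sq_nonneg x) (sq_nonneg y)]
    · -- y largest (y² ≥ z² ≥ x²)
      nlinarith [mul_le_mul_of_nonneg_left hxz (sq_nonneg y), mul_nonneg (sq_nonneg z) (sq_nonneg x)]
  · rcases le_total (y ^ 2) (x ^ 2) with hyx' | hxy'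
    · -- x largest
      nlinarith [mul_le_mul_of_nonneg_left hyz (sq_nonneg x), mul_nonneg (sq_nonneg z) (sq_nonneg y)]
    · -- y largest (y² ≥ x² ≥ z²)
      nlinarith [mul_le_mul_of_nonneg_left hxz (sq_nonneg y), mul_nonneg (sq_nonneg z) (sq_nonneg x)]

/-- `xy ≤ √μ`. [folklore] -/
theorem supAlgebra_xy_le_sqrt {x y z : ℝ} (hx : 0 ≤ x) (hy : 0 ≤ y) :
    x * y ≤ Real.sqrt (z ^ 2 * x ^ 2 + z ^ 2 * y ^ 2 + x ^ 2 * y ^ 2) := by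
  rw [show x * y = Real.sqrt ((x * y) ^ 2) by rw [Real.sqrt_sq (mul_nonneg hx hy)]]
  refine Real.sqrt_le_sqrt ?_
  nlinarith [mul_nonneg (sq_nonneg z) (sq_nonneg x), mul_nonneg (sq_nonneg z) (sq_nonneg y)]

/-- **The power-counting inequalities (registered sub-goal `supAlgebra_powerCounting` of stub B1b″).**
For `x, y, z ≥ 0`, `0 < η ≤ 1` with the support conditions `η² ≤ x²+y²`, `η² ≤ x²+z²`, `η² ≤ y²+z²`, and
`μ = z²x² + z²y² + x²y²`: `0 < μ` and the seven terms of the pointwise flux bound are `O(η⁻²)`: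
`(x²+y²)/μ ≤ 3/η²`, `xy(x+y)/(ημ) ≤ 3/η²`, `x²y²/(η²μ) ≤ 1/η²`, `xy(x+y)(x+y+z)/μ^{3/2} ≤ 9/η²`,
`x²y²(x+y+z)/(ημ^{3/2}) ≤ 3/η²`, `x²y²/μ^{3/2} ≤ 2/η²`, `x²y²(x+y+z)²/μ² ≤ 9/η²`. [folklore] -/
theorem supAlgebra_powerCounting :
    ∀ (x y z η : ℝ), 0 ≤ x → 0 ≤ y → 0 ≤ z → 0 < η → η ≤ 1 →
      η ^ 2 ≤ x ^ 2 + y ^ 2 → η ^ 2 ≤ x ^ 2 + z ^ 2 → η ^ 2 ≤ y ^ 2 + z ^ 2 →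
      0 < z ^ 2 * x ^ 2 + z ^ 2 * y ^ 2 + x ^ 2 * y ^ 2 ∧
      (x ^ 2 + y ^ 2) / (z ^ 2 * x ^ 2 + z ^ 2 * y ^ 2 + x ^ 2 * y ^ 2) ≤ 3 / η ^ 2 ∧
      x * y * (x + y) / (η * (z ^ 2 * x ^ 2 + z ^ 2 * y ^ 2 + x ^ 2 * y ^ 2)) ≤ 3 / η ^ 2 ∧
      x ^ 2 * y ^ 2 / (η ^ 2 * (z ^ 2 * x ^ 2 + z ^ 2 * y ^ 2 + x ^ 2 * y ^ 2)) ≤ 1 / η ^ 2 ∧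
      x * y * (x + y) * (x + y + z) / Real.sqrt (z ^ 2 * x ^ 2 + z ^ 2 * y ^ 2 + x ^ 2 * y ^ 2) ^ 3 ≤
        9 / η ^ 2 ∧
      x ^ 2 * y ^ 2 * (x + y + z) / (η * Real.sqrt (z ^ 2 * x ^ 2 + z ^ 2 * y ^ 2 + x ^ 2 * y ^ 2) ^ 3) ≤
        3 / η ^ 2 ∧
      x ^ 2 * y ^ 2 / Real.sqrt (z ^ 2 * x ^ 2 + z ^ 2 * y ^ 2 + x ^ 2 * y ^ 2) ^ 3 ≤ 2 / η ^ 2 ∧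
      x ^ 2 * y ^ 2 * (x + y + z) ^ 2 / (z ^ 2 * x ^ 2 + z ^ 2 * y ^ 2 + x ^ 2 * y ^ 2) ^ 2 ≤ 9 / η ^ 2 := by
  intro x y z η hx hy hz hη hη1 hxy hxz hyz
  set μ := z ^ 2 * x ^ 2 + z ^ 2 * y ^ 2 + x ^ 2 * y ^ 2 with hμ
  have hμ4 : η ^ 4 / 4 ≤ μ := supAlgebra_mu_ge hxy hxz hyz
  have hμpos : 0 < μ := lt_of_lt_of_le (by positivity) hμ4
  have hη2 : 0 < η ^ 2 := pow_pos hη 2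
  set s := Real.sqrt μ with hs
  have hs0 : 0 < s := Real.sqrt_pos.2 hμpos
  have hss : s * s = μ := Real.mul_self_sqrt hμpos.le
  have hs2 : s ^ 2 = μ := by rw [sq, hss]
  have hs3 : s ^ 3 = μ * s := by rw [pow_succ, hs2]
  -- the building blocks
  have hA : η ^ 2 * (x ^ 2 + y ^ 2 + z ^ 2) ≤ 3 * μ := supAlgebra_sumSq_le hxy hxz hyz
  have hB : (x + y + z) ^ 2 ≤ 3 * (x ^ 2 + y ^ 2 + z ^ 2) := by
    nlinarith [sq_nonneg (x - y), sq_nonneg (y - z), sq_nonneg (x - z)]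
  have hxy_s : x * y ≤ s := supAlgebra_xy_le_sqrt (z := z) hx hy
  have hxyn : 0 ≤ x * y := mul_nonneg hx hy
  have hsum0 : 0 ≤ x + y + z := by positivity
  -- `η (x+y+z) ≤ 3 s` (from `η²(x+y+z)² ≤ 9 μ = 9 s²`)
  have hL : η * (x + y + z) ≤ 3 * s := by
    have h9 : (η * (x + y + z)) ^ 2 ≤ (3 * s) ^ 2 := by
      calc (η * (x + y + z)) ^ 2 = η ^ 2 * (x + y + z) ^ 2 := by ring
        _ ≤ η ^ 2 * (3 * (x ^ 2 + y ^ 2 + z ^ 2)) := by gcongr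
        _ = 3 * (η ^ 2 * (x ^ 2 + y ^ 2 + z ^ 2)) := by ring
        _ ≤ 3 * (3 * μ) := by gcongr
        _ = (3 * s) ^ 2 := by rw [← hs2]; ring
    exact (pow_le_pow_iff_left₀ (by positivity) (by positivity) two_ne_zero).1 h9
  have hxyL : η * (x + y) ≤ 3 * s := by nlinarith [hL, hz, hη.le]
  -- `η² ≤ 2 s` (from `η⁴/4 ≤ μ = s²`)
  have hηs : η ^ 2 ≤ 2 * s := by nlinarith [hμ4, hs2, hs0]
  have hx2y2 : x ^ 2 * y ^ 2 ≤ μ := by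
    rw [hμ]; exact le_add_of_nonneg_left (by positivity)
  refine ⟨hμpos, ?_, ?_, ?_, ?_, ?_, ?_, ?_⟩
  · -- (x²+y²)/μ ≤ 3/η²
    rw [div_le_div_iff₀ hμpos hη2]
    have : η ^ 2 * (x ^ 2 + y ^ 2) ≤ η ^ 2 * (x ^ 2 + y ^ 2 + z ^ 2) :=
      mul_le_mul_of_nonneg_left (by nlinarith [sq_nonneg z]) hη2.le
    linarith
  · -- xy(x+y)/(ημ) ≤ 3/η²  ⟸  η xy(x+y) ≤ 3 μ  ⟸  xy ≤ s, η(x+y) ≤ 3s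
    rw [div_le_div_iff₀ (mul_pos hη hμpos) hη2]
    have : η * (x * y * (x + y)) ≤ s * (3 * s) := by
      calc η * (x * y * (x + y)) = (x * y) * (η * (x + y)) := by ring
        _ ≤ s * (3 * s) := mul_le_mul hxy_s hxyL (by positivity) hs0.le
    nlinarith [this, hss, hη.le]
  · -- x²y²/(η²μ) ≤ 1/η²
    rw [div_le_div_iff₀ (mul_pos hη2 hμpos) hη2]
    calc x ^ 2 * y ^ 2 * η ^ 2 ≤ μ * η ^ 2 := by gcongr
      _ = 1 * (η ^ 2 * μ) := by ring
  · -- xy(x+y)(x+y+z)/s³ ≤ 9/η²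
    rw [div_le_div_iff₀ (pow_pos hs0 3) hη2, hs3]
    have h1 : η * (x + y) * (η * (x + y + z)) ≤ (3 * s) * (3 * s) :=
      mul_le_mul hxyL hL (by positivity) (by positivity)
    calc x * y * (x + y) * (x + y + z) * η ^ 2 = (x * y) * (η * (x + y) * (η * (x + y + z))) := by ring
      _ ≤ s * ((3 * s) * (3 * s)) := mul_le_mul hxy_s h1 (by positivity) hs0.le
      _ = 9 * (μ * s) := by rw [← hss]; ring
  · -- x²y²(x+y+z)/(η s³) ≤ 3/η²
    rw [div_le_div_iff₀ (mul_pos hη (pow_pos hs0 3)) hη2, hs3]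
    calc x ^ 2 * y ^ 2 * (x + y + z) * η ^ 2 = (x ^ 2 * y ^ 2) * (η * (x + y + z)) * η := by ring
      _ ≤ μ * (3 * s) * η := by gcongr
      _ = 3 * (η * (μ * s)) := by ring
  · -- x²y²/s³ ≤ 2/η²
    rw [div_le_div_iff₀ (pow_pos hs0 3) hη2, hs3]
    calc x ^ 2 * y ^ 2 * η ^ 2 ≤ μ * (2 * s) := mul_le_mul hx2y2 hηs hη2.le hμpos.le
      _ = 2 * (μ * s) := by ring
  · -- x²y²(x+y+z)²/μ² ≤ 9/η²
    rw [div_le_div_iff₀ (pow_pos hμpos 2) hη2]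
    have h2 : η ^ 2 * (x + y + z) ^ 2 ≤ 9 * μ := by
      calc η ^ 2 * (x + y + z) ^ 2 ≤ η ^ 2 * (3 * (x ^ 2 + y ^ 2 + z ^ 2)) := by gcongr
        _ = 3 * (η ^ 2 * (x ^ 2 + y ^ 2 + z ^ 2)) := by ring
        _ ≤ 3 * (3 * μ) := by gcongr
        _ = 9 * μ := by ring
    calc x ^ 2 * y ^ 2 * (x + y + z) ^ 2 * η ^ 2 = (x ^ 2 * y ^ 2) * (η ^ 2 * (x + y + z) ^ 2) := by ring
      _ ≤ μ * (9 * μ) := mul_le_mul hx2y2 h2 (by positivity) hμpos.le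
      _ = 9 * μ ^ 2 := by ring

end Summit.AtomisticToContinuum.FouriersLaw.Theorems.DrudeDissolution.KineticPolymerGasOnTheTimeAxis

end
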